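import Literature.InformationTheory.QuantumCodes.QuantumExpanderThresholdMinMax
import HarnessLib

/-!
# The syndrome adjacency graph `𝒢` of a CSS-type decoding problem on `V ⊔ C_X` (Fawzi–Grospellier–Leverrier, FOCS 2018, §3.4) —
# DEFINITION and degree bounds

Index of sources: `[cite: FawziGrospellierLeverrier2018FT]` = Fawzi–Grospellier–Leverrier, FOCS 2018 / arXiv:1808.03821, §3.4 (p0019 L3-4): "we define
`𝒢` called the syndrome adjacency graph of the code in the following way: `𝒢` is equal to `G_X` with additional edges between the qubits which
share an `X`-type or a `Z`-type generator. In other words, the set of vertices of `𝒢` is indexed by `𝒱 := V ∪ C_X` the set of qubits and the set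
of `Z`-type generators, a `Z`-type generator is incident to the qubits in its support and two qubits are linked when they are both in the support
of the same generator. Note that the degree of `𝒢` is upper bounded by `d`"; Def. 20 / Lemma 27 (`α`-subsets and `α`-percolation are taken in `𝒢`).

Topic `Literature/InformationTheory/QuantumCodes` (venture QEC, row 04 `prover-qec-type-04` gen 8, line L-SSF-NOISY = PARTITION v2.48 D50.L8). Column
word: DEFINITION (+ small PROVED API). Generic over a syndrome matrix `Hs : C × Q` and a generator matrix `Hg : R × Q` on the qubit set `Q`; the
qubit–qubit edges are exactly the tree's `checkGraph (Matrix.fromRows Hs Hg)` ("share a check of `Hs` or a generator of `Hg`"), the qubit–check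
edges are the incidences of `Hs`, and there are no check–check edges. This is the graph the noisy-syndrome files
(`QuantumExpanderNoisySyndromeCluster.lean`, `…Lemma26.lean`) take as a parameter `G'` with the two edge hypotheses `hlift`, `hinc`; both are
discharged here by `Iff.rfl`-level lemmas, and the degree bound needed by the tree's `α`-percolation bound (`sum_hasAlphaCluster_le_geometric`,
FGL18b Lemma 27) is proved: `deg(inl q) ≤ z + (column weight of Hs at q)`, `deg(inr c) ≤ (row weight of Hs at c)`; for the quantum expander code
`Q_G`: `≤ 2·max Δ·(Δ_A + Δ_B − 1) + (Δ_A + Δ_B)`.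

* `syndromeAdjGraph Hs Hg : SimpleGraph (Q ⊕ C)` — the definition; `syndromeAdjGraph_adj_inl_inl` / `_inl_inr` / `_inr_inl` / `_inr_inr`;
* `degree_syndromeAdjGraph_inl_le`, `degree_syndromeAdjGraph_inr_le` — generic degree bounds;
* `QuantumExpander.degree_syndromeAdjGraph_le` — the bound for `Q_G` (`Hs = expanderHX H`, `Hg = expanderHZ H`).
-/

namespace Literature.InformationTheory.QuantumCodes

open Finset Matrix

namespace SmallSetFlip

variable {Q C R : Type*}

/-- **The syndrome adjacency graph `𝒢` on `V ⊔ C_X`** (FGL18b §3.4): qubits `inl q`, `inl q'` are adjacent iff they share a check of `Hs` or a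
generator of `Hg` (the tree's `checkGraph (Matrix.fromRows Hs Hg)`); a qubit `inl q` and a check `inr c` are adjacent iff `Hs c q ≠ 0`; checks are
never adjacent to each other. [cite: FawziGrospellierLeverrier2018FT, §3.4 (definition of 𝒢; arXiv p0019 L3-4)] -/
def syndromeAdjGraph (Hs : Matrix C Q (ZMod 2)) (Hg : Matrix R Q (ZMod 2)) : SimpleGraph (Q ⊕ C) where
  Adj x y := match x, y with
    | Sum.inl q, Sum.inl q' => (checkGraph (Matrix.fromRows Hs Hg)).Adj q q'
    | Sum.inl q, Sum.inr c => Hs c q ≠ 0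
    | Sum.inr c, Sum.inl q => Hs c q ≠ 0
    | Sum.inr _, Sum.inr _ => False
  symm := ⟨by
    intro x y h
    cases x with
    | inl q =>
      cases y with
      | inl q' => exact (checkGraph (Matrix.fromRows Hs Hg)).adj_symm h
      | inr c => exact h
    | inr c =>
      cases y with
      | inl q => exact h
      | inr c' => exact h.elim⟩
  loopless := ⟨by
    intro x h
    cases x with
    | inl q => exact (checkGraph (Matrix.fromRows Hs Hg)).irrefl h
    | inr c => exact h.elim⟩

/-- Qubit–qubit adjacency in `𝒢` is the check/generator adjacency. [cite: FawziGrospellierLeverrier2018FT, §3.4 (arXiv p0019 L3-4)] -/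
theorem syndromeAdjGraph_adj_inl_inl (Hs : Matrix C Q (ZMod 2)) (Hg : Matrix R Q (ZMod 2)) (q q' : Q) :
    (syndromeAdjGraph Hs Hg).Adj (Sum.inl q) (Sum.inl q') ↔ (checkGraph (Matrix.fromRows Hs Hg)).Adj q q' := Iff.rfl

/-- Qubit–check adjacency in `𝒢` is incidence in `Hs`. [cite: FawziGrospellierLeverrier2018FT, §3.4 (arXiv p0019 L3-4)] -/
theorem syndromeAdjGraph_adj_inl_inr (Hs : Matrix C Q (ZMod 2)) (Hg : Matrix R Q (ZMod 2)) (q : Q) (c : C) :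
    (syndromeAdjGraph Hs Hg).Adj (Sum.inl q) (Sum.inr c) ↔ Hs c q ≠ 0 := Iff.rfl

/-- Check–qubit adjacency in `𝒢` is incidence in `Hs`. [cite: FawziGrospellierLeverrier2018FT, §3.4 (arXiv p0019 L3-4)] -/
theorem syndromeAdjGraph_adj_inr_inl (Hs : Matrix C Q (ZMod 2)) (Hg : Matrix R Q (ZMod 2)) (c : C) (q : Q) :
    (syndromeAdjGraph Hs Hg).Adj (Sum.inr c) (Sum.inl q) ↔ Hs c q ≠ 0 := Iff.rfl

/-- No check–check edges in `𝒢`. [cite: FawziGrospellierLeverrier2018FT, §3.4 (arXiv p0019 L3-4)] -/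
theorem syndromeAdjGraph_not_adj_inr_inr (Hs : Matrix C Q (ZMod 2)) (Hg : Matrix R Q (ZMod 2)) (c c' : C) :
    ¬ (syndromeAdjGraph Hs Hg).Adj (Sum.inr c) (Sum.inr c') := fun h => h.elim

variable [Fintype Q] [Fintype C] [DecidableEq Q] [DecidableEq C]

/-- **Degree of a qubit vertex**: `deg_𝒢(inl q) ≤ deg(q)` in the qubit adjacency graph `+` the number of checks of `Hs` on `q`.
[cite: FawziGrospellierLeverrier2018FT, §3.4 ("the degree of 𝒢 is upper bounded by d"; arXiv p0019 L4)] -/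
theorem degree_syndromeAdjGraph_inl_le (Hs : Matrix C Q (ZMod 2)) (Hg : Matrix R Q (ZMod 2))
    [DecidableRel (syndromeAdjGraph Hs Hg).Adj] [DecidableRel (checkGraph (Matrix.fromRows Hs Hg)).Adj]
    {z col : ℕ} (hz : ∀ q, (checkGraph (Matrix.fromRows Hs Hg)).degree q ≤ z)
    (hcol : ∀ q, (univ.filter fun c => Hs c q ≠ 0).card ≤ col) (q : Q) :
    (syndromeAdjGraph Hs Hg).degree (Sum.inl q) ≤ z + col := by
  classical
  rw [← SimpleGraph.card_neighborFinset_eq_degree]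
  have hsub : (syndromeAdjGraph Hs Hg).neighborFinset (Sum.inl q)
      ⊆ ((checkGraph (Matrix.fromRows Hs Hg)).neighborFinset q).map Function.Embedding.inl
        ∪ (univ.filter fun c => Hs c q ≠ 0).map Function.Embedding.inr := by
    intro y hy
    rw [SimpleGraph.mem_neighborFinset] at hy
    rw [Finset.mem_union, Finset.mem_map, Finset.mem_map]
    cases y with
    | inl q' => exact Or.inl ⟨q', (SimpleGraph.mem_neighborFinset _ _ _).2 hy, rfl⟩
    | inr c => exact Or.inr ⟨c, Finset.mem_filter.2 ⟨Finset.mem_univ _, hy⟩, rfl⟩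
  refine (Finset.card_le_card hsub).trans ((Finset.card_union_le _ _).trans ?_)
  rw [Finset.card_map, Finset.card_map, SimpleGraph.card_neighborFinset_eq_degree]
  exact Nat.add_le_add (hz q) (hcol q)

omit [DecidableEq Q] [DecidableEq C] in
/-- **Degree of a check vertex**: `deg_𝒢(inr c) ≤` the row weight of `Hs` at `c`.
[cite: FawziGrospellierLeverrier2018FT, §3.4 (arXiv p0019 L4)] -/
theorem degree_syndromeAdjGraph_inr_le (Hs : Matrix C Q (ZMod 2)) (Hg : Matrix R Q (ZMod 2))
    [DecidableRel (syndromeAdjGraph Hs Hg).Adj]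
    {w : ℕ} (hrow : ∀ c, (univ.filter fun q => Hs c q ≠ 0).card ≤ w) (c : C) :
    (syndromeAdjGraph Hs Hg).degree (Sum.inr c) ≤ w := by
  classical
  rw [← SimpleGraph.card_neighborFinset_eq_degree]
  have hsub : (syndromeAdjGraph Hs Hg).neighborFinset (Sum.inr c)
      ⊆ (univ.filter fun q => Hs c q ≠ 0).map Function.Embedding.inl := by
    intro y hy
    rw [SimpleGraph.mem_neighborFinset] at hy
    rw [Finset.mem_map]
    cases y with
    | inl q => exact ⟨q, Finset.mem_filter.2 ⟨Finset.mem_univ _, hy⟩, rfl⟩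
    | inr c' => exact hy.elim
  refine (Finset.card_le_card hsub).trans ?_
  rw [Finset.card_map]
  exact hrow c

end SmallSetFlip

namespace QuantumExpander

variable {A B : Type*} [Fintype A] [Fintype B] [DecidableEq A] [DecidableEq B]

/-- **The degree of the syndrome adjacency graph of the quantum expander code `Q_G`** (`Hs = expanderHX H`, `Hg = expanderHZ H`, `(Δ_A, Δ_B)`-biregular):
every vertex has degree `≤ 2·max(Δ_A,Δ_B)·(Δ_A + Δ_B − 1) + (Δ_A + Δ_B)` (qubit: `deg` in `checkGraph (H_X; H_Z)` — the tree's
`degree_checkGraph_fromRows_le_max` — plus `≤ max Δ` incident `σ_X`-checks; check: row weight `Δ_A + Δ_B` of `H_X`). This is the `d = maxDeg` of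
FGL18b Lemma 27 for `Q_G` (a bound, not the sharp value). [cite: FawziGrospellierLeverrier2018FT, §3.4 and Lemma 27 ("d := maxDeg"; arXiv p0019 L4, p0021 L12-14)] -/
theorem degree_syndromeAdjGraph_le (H : Matrix B A (ZMod 2)) {dA dB : ℕ} (hreg : IsBiregular H dA dB)
    [DecidableRel (SmallSetFlip.syndromeAdjGraph (expanderHX H) (expanderHZ H)).Adj]
    [DecidableRel (checkGraph (Matrix.fromRows (expanderHX H) (expanderHZ H))).Adj]
    (x : ((A × A) ⊕ (B × B)) ⊕ (A × B)) :
    (SmallSetFlip.syndromeAdjGraph (expanderHX H) (expanderHZ H)).degree x ≤ 2 * max dA dB * (dA + dB - 1) + (dA + dB) := by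
  classical
  have hcol : ∀ q : (A × A) ⊕ (B × B), (univ.filter fun c : A × B => expanderHX H c q ≠ 0).card ≤ max dA dB := by
    intro q
    have h := hammingNorm_expanderHX_mulVec_le_max H hreg (flipVec {q})
    rw [hammingNorm_flipVec, Finset.card_singleton, mul_one] at h
    have hset : (univ.filter fun c : A × B => expanderHX H c q ≠ 0)
        = univ.filter fun c : A × B => (expanderHX H *ᵥ flipVec {q}) c ≠ 0 := by
      ext c
      simp only [Finset.mem_filter, Finset.mem_univ, true_and, Matrix.mulVec, dotProduct, flipVec,
        Finset.mem_singleton, mul_ite, mul_one, mul_zero, Finset.sum_ite_eq', Finset.mem_univ, if_true]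
    rw [hset]; exact h
  have hrow : ∀ c : A × B, (univ.filter fun q : (A × A) ⊕ (B × B) => expanderHX H c q ≠ 0).card ≤ dA + dB := by
    rintro ⟨α, β⟩
    have h := hammingNorm_expanderHX_row_le H hreg α β
    simpa [hammingNorm] using h
  cases x with
  | inl q =>
    refine (SmallSetFlip.degree_syndromeAdjGraph_inl_le _ _ (degree_checkGraph_fromRows_le_max H hreg) hcol q).trans ?_
    have : max dA dB ≤ dA + dB := max_le (Nat.le_add_right _ _) (Nat.le_add_left _ _)
    omega
  | inr c =>
    refine (SmallSetFlip.degree_syndromeAdjGraph_inr_le _ _ hrow c).trans ?_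
    omega

end QuantumExpander

end Literature.InformationTheory.QuantumCodes
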